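/-
Copyright (c) 2026 the pub-hodgecm-mathlib formalisation cell (harness21).  Prover seat hodgecm-mathlib-K2E4-p11 (g2), Track B ∕ K2-LIT
(build stream 29), h413 = `stmt-HodgeConjecture-24833`, engine E2 line `K2_E2_ThetaExhaustionByRigidity`, unit CAPTURE, socket #20a
«ARCH-PAIR-HOLCOT» — helper H4b «ORIENTATION MIRROR», glue file ((m1′) + (m5) of K2E2-p13 (g2)'s CUT 2026-09-04T00:14:35Z).  2026-09-04.
-/
import Summits.HodgeConjecture.HodgeConjecture.Theorems.H413MirrorAtPinLine               -- ★ `MirrorAtPinLine.lineChar_eq_of_val_eq` (+ the mirror of the pin's splitting, for H4b)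
import Summits.HodgeConjecture.CorCM.D2Bridge.WeilFinRepMirror                              -- ★ `UnitaryGroup.adelic_neg` (`U(−J_W)(𝔸) = U(J_W)(𝔸)`)
import Literature.NumberTheory.Automorphic.Liu2021.Def411ChiAutomorphicQuotient              -- ★ `chiQuot`, `charCM_chiQuot_mk`
import Literature.NumberTheory.Automorphic.Liu2021.Def411ChiGaloisTwist                      -- ★ `isAutomorphicOneChar_unitsMap_comp_chi` (`χ̄ ∈ Chi`)
import Literature.NumberTheory.Automorphic.DoubledUnitaryRankOneReductionDiag                -- ★ `DoubledUnitary.RankOneReduction.mem_range_toAdelic_iff`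
import Literature.NumberTheory.Weil1964.AdelicSchrodingerConjCont                            -- ★ `schwartzConj`
import Literature.NumberTheory.Weil1964.AdelicMetaplecticReindex                             -- ★ `schwartzReindexCLM`
import Literature.NumberTheory.Weil1964.ArchDualPairNoPositiveCharacter                      -- ★ `continuous_subgroupCongr`
import Summits.HodgeConjecture.CorCM.B01.Transposition.HComp.RecordSystemConjOmegaTwistCompatible  -- ★ `OmegaConj.JW_neg` (`J_W(−a) = −J_W(a)`)
import HarnessLib

/-!
# K2 ∕ E2 «ThetaExhaustionByRigidity», unit CAPTURE, socket #20a — H4b «ORIENTATION MIRROR», GLUE: the `W`-side identification `U(⟨a⟩) = U(⟨−a⟩)`,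
# the line character `χ̃_χ ↦ χ̃_{χ̄}`, and `conj` versus the archimedean re-enumeration

Cell `hodgecm-mathlib` (FLOOR 0), Track B «K2-LIT», engine E2, crux item H413 = `stmt-HodgeConjecture-24833` (route of record `HCCMUnconditional`, no route verbs);
helper of socket #20a `sig_K2E2CapArchPairHolCot` «ARCH-PAIR-HOLCOT» on the H4 «MIRROR» branch (deal K2E2-plan (g2) 2026-09-04T00:22:30Z; spec = K2E2-p13 (g2) CUT
00:14:35Z, items (m1′) + (m5)); consumed by H4b `Theorems/K2E2CapArchPairMirror.lean` together with K2E2-p13's H4a kit.  Author K2E4-p11 (g2).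
`--supports stmt-HodgeConjecture-24833 --as helper`; THEOREMS ONLY (no `def`, no `instance`, no notation, no `sorry`); imports ★ only.

* §1 (m1′) `adelic_JW_neg_eq` — `U(J_W(−a))(𝔸) = U(J_W(a))(𝔸)` as SUBGROUPS of `GL₁(𝔸_L)` (★ `adelic_neg`, ★ `OmegaConj.JW_neg`), so the identification
  `e := MulEquiv.subgroupCongr …` needs no definition; it matches the rational points (`subgroupCongr_JW_neg_mem_range_iff`, ★ `mem_range_toAdelic_iff`) and is
  bicontinuous (★ `Weil1964.continuous_subgroupCongr`, `continuous_subgroupCongr_symm`) — the `e ∕ hΓ ∕ he ∕ hes` of K2E2-p13's ★ `thetaLift_conj_cosetCongr_apply_map`; the quotient map, the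
  transported measure and its finiteness ∕ invariance ∕ positivity are the tree's ★ `cosetCongr` API (`MeasureTheory/Group/{InvariantQuotientTransport, CosetSpaceLpTransport}`).
* §2 (m5) the line character: `charCM_chiQuot_neg_conj_apply` — `χ̃_{χ̄, −a}([e⁻¹ u]) = conj (χ̃_{χ, a}([u]))` for `χ̄ := conj ∘ χ ∈ Chi`
  (★ `charCM_chiQuot_mk`, ★ `lineChar_eq_of_val_eq`: the line character reads the matrix only) — the weight match `hf` of the conj transport.
* §3 (m5) `schwartzConj_schwartzReindexCLM` — complex conjugation commutes with the archimedean re-enumeration `R^∞_e`; `schwartzConj_eq_zero_iff`.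

HONEST LABEL.  HC_CM is proved only modulo the 7 printed citations (2 remaining named inputs: hLiu418 = stmt-HodgeConjecture-24832, h413 = stmt-HodgeConjecture-24833)
until rung 0 closes; count-neutral glue.

## References
* [Liu2021] Y. Liu, Camb. J. Math. 9 (2021) = arXiv:2102.11518: Def. 4.11 (l. 2090–2096); App. D §D.1 Steps 1, 3 (l. 5215, 5221); App. D Lemma D.1 (2) (l. 5231).
* [Kudla1994] S. Kudla, Israel J. Math. 87 (1994), §2.
* [FleigEtAl2018] P. Fleig, H. Gustafsson, A. Kleinschmidt, D. Persson, CUP (2018), §12.3 Def. 12.5 (12.37) p. 296 (theta lifts as integrals over `[H]`).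
-/

set_option autoImplicit false
set_option linter.dupNamespace false

noncomputable section

namespace Summit.HodgeConjecture.HodgeConjecture.Cruxes.H413.K2E2CapArchPairMirrorGlue

open scoped ComplexConjugate Pointwise Classical
open NumberField NumberField.InfinitePlace NumberField.mixedEmbedding IsDedekindDomain MeasureTheory MulAction
open Literature.NumberTheory.Automorphic Literature.NumberTheory.Automorphic.UnitaryGroup
open Literature.NumberTheory.Automorphic.Liu2021 Literature.NumberTheory.Automorphic.Liu2021.Def411WeilCarriers
open Literature.NumberTheory.Weil1964
open Literature.RepresentationTheory.CompactGroups
open Summit.HodgeConjecture.HodgeConjecture.Cruxes.H413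

/-! ## §1 (m1′) `U(⟨−a⟩)(𝔸) = U(⟨a⟩)(𝔸)` as subgroups; the identification matches the rational points and is bicontinuous -/

section Subgroups

variable (F E : Type) [Field F] [NumberField F] [Field E] [NumberField E] [Algebra F E] (c : E ≃ₐ[F] E)

omit [NumberField F] in
/-- **(m1′) `U(J_W(−a))(𝔸_F) = U(J_W(a))(𝔸_F)` as SUBGROUPS of `GL₁(𝔸_E)`** (`uᴴ(−J)u = −J ⟺ uᴴJu = J`; ★ `adelic_neg`) — so the identification
`e := MulEquiv.subgroupCongr (adelic_JW_neg_eq a) : U(J_W(−a))(𝔸) ≃* U(J_W(a))(𝔸)` is the identity on matrices (no new definition).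
[cite: Kudla1994, §2] [cite: Liu2021, App. D §D.1 Step 1 (l. 5215)] -/
theorem adelic_JW_neg_eq (a : Fˣ) : adelic F E c 1 (JW F E (-a)) = adelic F E c 1 (JW F E a) := by
  rw [Summit.HodgeConjecture.CorCM.HComp.OmegaConj.JW_neg, adelic_neg]

omit [NumberField F] in
/-- **the identification matches the rational points** (the `hΓ` of ★ `cosetCongr` ∕ of `K2E2CapArchPairMirrorKit.thetaLift_conj_cosetCongr_apply_map`):
rationality of an adelic point is a condition on its matrix (★ `mem_range_toAdelic_iff`), which `subgroupCongr` does not change.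
[cite: Liu2021, App. D §D.1 Step 1 (l. 5215)] [cite: GelbartRogawski1991, §3.1 p. 454] -/
theorem subgroupCongr_JW_neg_mem_range_iff (a : Fˣ) (y : ↥(adelic F E c 1 (JW F E (-a)))) :
    MulEquiv.subgroupCongr (adelic_JW_neg_eq F E c a) y ∈ (toAdelic F E c 1 (JW F E a)).range ↔
      y ∈ (toAdelic F E c 1 (JW F E (-a))).range := by
  -- (read through ★ `MulEquiv.subgroupCongr_apply`, never by unfolding the two unitary conditions)
  rw [DoubledUnitary.RankOneReduction.mem_range_toAdelic_iff, DoubledUnitary.RankOneReduction.mem_range_toAdelic_iff,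
    MulEquiv.subgroupCongr_apply]

end Subgroups

/-- the inverse of `subgroupCongr h` is continuous (the forward map is ★ `Literature.NumberTheory.Weil1964.continuous_subgroupCongr`). [folklore] -/
theorem continuous_subgroupCongr_symm {G : Type*} [Group G] [TopologicalSpace G] {A B : Subgroup G} (h : A = B) :
    Continuous (MulEquiv.subgroupCongr h).symm := by
  subst h
  exact continuous_id

/-! ## §2 (m5) The line character: `χ̃_{χ̄, −a}([ū]) = conj χ̃_{χ, a}([u])` -/

section LineCharacter

variable (F E : Type) [Field F] [NumberField F] [Field E] [NumberField E] [Algebra F E] (c : E ≃ₐ[F] E)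
  (h2 : Module.finrank F E = 2) (hc : c ≠ 1)

/-- **the mirror line character**: for `χ ∈ Chi` and `χ̄ := conj ∘ χ ∈ Chi` (★ `isAutomorphicOneChar_unitsMap_comp_chi`), along the identification
`U(J_W(−a))(𝔸) = U(J_W(a))(𝔸)` (inverse direction `u ↦ ū`) the automorphic characters `χ̃` of [Liu2021, proof of Prop. 4.13] satisfy `χ̃_{χ̄, −a}([ū]) = conj (χ̃_{χ, a}([u]))`
(the line character reads the matrix of `u_f` only, ★ `lineChar_eq_of_val_eq`). [cite: Liu2021, App. D §D.1 Step 3 (l. 5221); proof of Prop. 4.13 (l. 2145)] -/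
theorem charCM_chiQuot_neg_conj_apply (a : Fˣ) (χ : Chi F E c)
    [(toAdelic F E c 1 (JW F E a)).range.Normal] [(toAdelic F E c 1 (JW F E (-a))).range.Normal]
    (u : ↥(adelic F E c 1 (JW F E a))) :
    charCM (chiQuot F E c h2 hc (-a) ⟨(Units.map ((starRingEnd ℂ : ℂ →+* ℂ) : ℂ →* ℂ)).comp χ.1, isAutomorphicOneChar_unitsMap_comp_chi c χ _⟩)
        (QuotientGroup.mk ((MulEquiv.subgroupCongr (adelic_JW_neg_eq F E c a)).symm u)) =
      conj (charCM (chiQuot F E c h2 hc a χ) (QuotientGroup.mk u)) := by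
  have hu : (((finPart F E c 1 (JW F E (-a)) ((MulEquiv.subgroupCongr (adelic_JW_neg_eq F E c a)).symm u) :
        finAdelic F E c 1 (JW F E (-a))) : GL (Fin 1) (FiniteAdeleRing (𝓞 E) E)) : Matrix (Fin 1) (Fin 1) (FiniteAdeleRing (𝓞 E) E)) =
      ((finPart F E c 1 (JW F E a) u : finAdelic F E c 1 (JW F E a)) : GL (Fin 1) (FiniteAdeleRing (𝓞 E) E)) := by
    rw [coe_finPart, coe_finPart, adelicVal_apply, adelicVal_apply, MulEquiv.subgroupCongr_symm_apply]
  rw [charCM_chiQuot_mk, charCM_chiQuot_mk,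
    MirrorAtPinLine.lineChar_eq_of_val_eq F E c a (-a) χ.1 ((starRingEnd ℂ : ℂ →+* ℂ) : ℂ →* ℂ) _ _ hu]
  rfl

end LineCharacter

/-! ## §3 (m5) `conj` and the archimedean re-enumeration -/

section Schwartz

variable (K : Type) [Field K] [NumberField K] {ι ι' : Type} [Fintype ι] [Fintype ι'] (e : ι ≃ ι')

/-- `C (R^∞_e φ) = R^∞_e (C φ)`: complex conjugation commutes with re-enumeration of the archimedean coordinates. [folklore] -/
theorem schwartzConj_schwartzReindexCLM (φ : SchwartzMap (ι → NumberField.mixedEmbedding.mixedSpace K) ℂ) :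
    schwartzConj (schwartzReindexCLM K e φ) = schwartzReindexCLM K e (schwartzConj φ) := by
  ext w
  rw [schwartzConj_apply, schwartzReindexCLM_apply, schwartzReindexCLM_apply, schwartzConj_apply]

/-- `C φ = 0 ↔ φ = 0`. [folklore] -/
theorem schwartzConj_eq_zero_iff (φ : SchwartzMap (ι → NumberField.mixedEmbedding.mixedSpace K) ℂ) : schwartzConj φ = 0 ↔ φ = 0 := by
  constructor
  · intro h
    rw [← schwartzConj_schwartzConj φ, h]
    ext x
    rw [schwartzConj_apply]
    show conj ((0 : SchwartzMap (ι → NumberField.mixedEmbedding.mixedSpace K) ℂ) x) = 0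
    rw [show ((0 : SchwartzMap (ι → NumberField.mixedEmbedding.mixedSpace K) ℂ) x) = 0 from rfl, map_zero]
  · intro h
    rw [h]
    ext x
    rw [schwartzConj_apply]
    show conj ((0 : SchwartzMap (ι → NumberField.mixedEmbedding.mixedSpace K) ℂ) x) = 0
    rw [show ((0 : SchwartzMap (ι → NumberField.mixedEmbedding.mixedSpace K) ℂ) x) = 0 from rfl, map_zero]

end Schwartz

end Summit.HodgeConjecture.HodgeConjecture.Cruxes.H413.K2E2CapArchPairMirrorGlue

end
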